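import Summits.ValiantsHypothesis.ValiantsHypothesis.Theorems.LangWeilTransferTameResolutionEliminantPrelims

/-!
# LangWeilTransfer, support item `TameResolution` (stmt-ValiantsHypothesis-6378) — the relative
# eliminant identity at a component amid higher-dimensional components

Route `LangWeilTransfer` of `ValiantsHypothesis` (conditional route; honest framing: bookkeeping,
nothing here bears on VP ≠ VNP). Setting ((R) of the architecture note of val-lit-p6 g9): a
system `S_1, …, S_t ∈ ℤ[T_1..T_r][X_1..X_n]` (the original equations in coordinates split into
parameters `T` and fibre variables `X`), and a ring homomorphism `φ : ℤ[T][X] → F₀` to a field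
(evaluation at the generic point `(T̄, ξ)` of a component `V(𝔭)`, `𝔭 = ker φ`) such that
`ℤ[T] → F₀` is injective (`T̄` algebraically independent), every `ξ_j = φ(X_j)` is algebraic over
`ℤ[T̄]`, the `S_k` vanish at the point, and `ker φ` is the only prime between `(S)` and `ker φ`
(minimality of the component). Over the universal coefficient ring
`R_u = ℤ[T, α_{ik}, Λ_j]` form the square system `F_i = Σ_k α_{ik} S_k`, the generic linear form
`u = Σ_j Λ_j X_j`, and `Q = sLead (pertCharpoly (d+1) F u k₀) ∈ R_u[U]` (Canny's generalised
characteristic polynomial, tree `PerturbedCharpoly.lean`).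

* `eliminant_identity` — **`Q(T̄, α, Λ, Σ_j Λ_j ξ_j) = 0` identically in `F₀[α, Λ]`.**

Proof: over `K₂` = algebraic closure of `K₁(α)` (`K₁ = F₀^alg`, `α` indeterminates, a
transcendence basis of `K₂/K₁`) the point `ξ` is an ISOLATED zero of `F^{K₂}`: a prime `P` with
`(F) ⊆ P ⊆ 𝔪_ξ` either misses some `S_k` — then it is maximal by
`isMaximal_of_generic_combinations` (transcendence degree) — or contains `(S)`, contracts to
`ker φ` by minimality, hence contains the images of the coordinate equations of the `ξ_j`, has
finite zero set and is maximal (`isMaximal_of_zeroLocus_finite`). So the local limit lemma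
`eval_sLead_pertCharpoly_eq_zero_of_isolated` gives `Q(…, Σ c_j ξ_j) = 0` for every `c ∈ K₂ⁿ`,
a polynomial identity in `Λ` over `K₂`, which descends to `F₀[α, Λ]` because `α` is algebraically
independent over `F₀`.
-/

noncomputable section

open MvPolynomial
open Literature.RingTheory.Elimination

-- the summit and the problem share the name `ValiantsHypothesis` (D-0017 single-conjunct layout)
set_option linter.dupNamespace false

namespace Summit.ValiantsHypothesis.ValiantsHypothesis.Theorems.LangWeilTransfer

/-! ### The eliminant identity -/

section Main

variable {F₀ : Type*} [Field F₀] {r n t d : ℕ}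

/-- **The relative eliminant identity at a component** (see the module docstring). With
`ι = T ⊔ Λ ⊔ α`, `R_u = ℤ[ι]`, `F_i = Σ_k α_{ik} S_k`, `u = Σ_j Λ_j X_j` and
`Q = sLead (pertCharpoly (d+1) F u (1 + n d + 1)) ∈ R_u[U]`: under the substitution
`T ↦ T̄ = φ(T)`, `Λ ↦ Λ`, `α ↦ α` into `F₀[Λ, α]` and `U ↦ Σ_j ξ_j Λ_j` (`ξ_j = φ(X_j)`), the
leading `s`-form `Q` vanishes identically. -/
theorem eliminant_identity
    (S : Fin t → MvPolynomial (Fin n) (MvPolynomial (Fin r) ℤ)) (hSd : ∀ k, (S k).totalDegree ≤ d)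
    (φ : MvPolynomial (Fin n) (MvPolynomial (Fin r) ℤ) →+* F₀)
    (hT : Function.Injective (φ.comp MvPolynomial.C))
    (halg : ∀ j, ∃ P : Polynomial (MvPolynomial (Fin r) ℤ), P ≠ 0 ∧
      (P.map (φ.comp MvPolynomial.C)).eval (φ (X j)) = 0)
    (hSφ : ∀ k, φ (S k) = 0)
    (hmin : ∀ 𝔮 : Ideal (MvPolynomial (Fin n) (MvPolynomial (Fin r) ℤ)), 𝔮.IsPrime →
      Ideal.span (Set.range S) ≤ 𝔮 → 𝔮 ≤ RingHom.ker φ → 𝔮 = RingHom.ker φ) :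
    let ι := Fin r ⊕ (Fin n ⊕ (Fin n × Fin t))
    let F : Fin n → MvPolynomial (Fin n) (MvPolynomial ι ℤ) := fun i =>
      ∑ k, C (X (Sum.inr (Sum.inr (i, k)))) *
        MvPolynomial.map (rename (Sum.inl : Fin r → ι) : MvPolynomial (Fin r) ℤ →ₐ[ℤ] MvPolynomial ι ℤ).toRingHom (S k)
    let u : MvPolynomial (Fin n) (MvPolynomial ι ℤ) := ∑ j, C (X (Sum.inr (Sum.inl j))) * X j
    let Ψ : MvPolynomial ι ℤ →+* MvPolynomial (Fin n ⊕ (Fin n × Fin t)) F₀ :=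
      eval₂Hom (Int.castRingHom _) (Sum.elim (fun k => C (φ (C (X k)))) (fun v => X v))
    ((sLead (pertCharpoly (d + 1) F u (1 + n * d + 1))).map Ψ).eval
      (∑ j, C (φ (X j)) * X (Sum.inl j)) = 0 := by
  intro ι F u Ψ
  classical
  -- the fields `K₁ = F₀^alg`, `K₂ = K₁(α)^alg` and the transcendence basis `α`
  let K₁ := AlgebraicClosure F₀
  let L := FractionRing (MvPolynomial (Fin n × Fin t) K₁)
  let K₂ := AlgebraicClosure L
  let j₁ : F₀ →+* K₁ := algebraMap F₀ K₁
  let j₂ : K₁ →+* K₂ := algebraMap K₁ K₂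
  let jK : F₀ →+* K₂ := j₂.comp j₁
  let α : Fin n × Fin t → K₂ := fun p =>
    algebraMap L K₂ (algebraMap (MvPolynomial (Fin n × Fin t) K₁) L (X p))
  have hα : IsTranscendenceBasis K₁ α := isTranscendenceBasis_genVar K₁ (Fin n × Fin t)
  let θ₁ : MvPolynomial (Fin r) ℤ →+* K₁ := j₁.comp (φ.comp MvPolynomial.C)
  let θ₂ : MvPolynomial (Fin r) ℤ →+* K₂ := j₂.comp θ₁
  let T₂ : Fin r → K₂ := fun k => jK (φ (C (X k)))
  let ξ₂ : Fin n → K₂ := fun j => j₂ (j₁ (φ (X j)))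
  let S₂ : Fin t → MvPolynomial (Fin n) K₂ := fun k =>
    MvPolynomial.map (algebraMap K₁ K₂) (MvPolynomial.map θ₁ (S k))
  let F₂ : Fin n → MvPolynomial (Fin n) K₂ := fun i => ∑ k, C (α (i, k)) * S₂ k
  set P := pertCharpoly (d + 1) F u (1 + n * d + 1) with hP
  -- the specialisations `ψ_c : R_u → K₂`, `Λ ↦ c`
  let ψ : (Fin n → K₂) → MvPolynomial ι ℤ →+* K₂ := fun c =>
    eval₂Hom (Int.castRingHom K₂) (Sum.elim T₂ (Sum.elim c α))
  have hψT : ∀ c, (ψ c).comp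
      (rename (Sum.inl : Fin r → ι) : MvPolynomial (Fin r) ℤ →ₐ[ℤ] MvPolynomial ι ℤ).toRingHom = θ₂ := by
    intro c
    refine MvPolynomial.ringHom_ext (fun b => ?_) (fun k => ?_)
    · simp only [ψ, AlgHom.toRingHom_eq_coe, eq_intCast, map_intCast]
    · simp only [ψ, θ₂, θ₁, j₂, jK, T₂, RingHom.comp_apply, AlgHom.toRingHom_eq_coe, RingHom.coe_coe,
        rename_X, eval₂Hom_X', Sum.elim_inl]
  have hψF : ∀ c i, MvPolynomial.map (ψ c) (F i) = F₂ i := by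
    intro c i
    simp only [F, F₂, S₂, map_sum, map_mul, MvPolynomial.map_C, MvPolynomial.map_map, hψT]
    refine Finset.sum_congr rfl fun k _ => ?_
    simp only [ψ, θ₂, j₂, eval₂Hom_X', Sum.elim_inr]
  have hψu : ∀ c, MvPolynomial.map (ψ c) u = ∑ j, C (c j) * X j := by
    intro c
    simp only [u, ψ, map_sum, map_mul, MvPolynomial.map_C, MvPolynomial.map_X, eval₂Hom_X', Sum.elim_inr,
      Sum.elim_inl]
  -- evaluation at the point
  have hevS : ∀ k, eval ξ₂ (S₂ k) = jK (φ (S k)) := by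
    intro k
    have : (eval ξ₂).comp ((MvPolynomial.map (algebraMap K₁ K₂)).comp (MvPolynomial.map θ₁)) =
        jK.comp φ := by
      refine MvPolynomial.ringHom_ext (fun b => ?_) (fun j => ?_)
      · simp only [RingHom.comp_apply, MvPolynomial.map_C, eval_C]; rfl
      · simp only [RingHom.comp_apply, MvPolynomial.map_X, eval_X]; rfl
    exact congrArg (fun h => h (S k)) this
  have hz : ∀ i, eval ξ₂ (F₂ i) = 0 := by
    intro i
    simp only [F₂, map_sum, map_mul, eval_C, hevS, hSφ, map_zero, mul_zero, Finset.sum_const_zero]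
  -- isolation of the point
  have hmax : ∀ P' : Ideal (MvPolynomial (Fin n) K₂), P'.IsPrime → Ideal.span (Set.range F₂) ≤ P' →
      P' ≤ vanishingIdeal K₂ {ξ₂} → P' = vanishingIdeal K₂ {ξ₂} := by
    intro P' hP' hle hPξ
    haveI := hP'
    have hFP : ∀ i, F₂ i ∈ P' := fun i => hle (Ideal.subset_span ⟨i, rfl⟩)
    have hM : P'.IsMaximal := isMaximal_of_le_point j₁ S φ hT halg hmin α hα P' hFP hPξ
    exact hM.eq_of_le (Ideal.IsMaximal.ne_top inferInstance) hPξ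
  obtain ⟨g, hg, -, hfin⟩ := exists_isolating_polynomial (Ideal.span (Set.range F₂)) ξ₂ hmax
  have hfin' : ({x : Fin n → K₂ | ∀ i, eval x (F₂ i) = 0} ∩ {x | eval x g ≠ 0}).Finite := by
    refine hfin.subset ?_
    rintro x ⟨hx, hxg⟩
    refine ⟨?_, hxg⟩
    rw [zeroLocus_span]
    rintro _ ⟨i, rfl⟩
    rw [aeval_eq_eval]; exact hx i
  -- the local limit lemma, for every `c`
  have hdeg : ∀ i, (F₂ i).totalDegree < d + 1 := by
    intro i
    refine Nat.lt_succ_of_le ((totalDegree_finsetSum _ _).trans (Finset.sup_le fun k _ => ?_))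
    refine (totalDegree_mul _ _).trans ?_
    rw [totalDegree_C, zero_add]
    exact (totalDegree_map_le' _ _).trans ((totalDegree_map_le' _ _).trans (hSd k))
  have hlim : ∀ c : Fin n → K₂, ((sLead P).map (ψ c)).eval (∑ j, c j * ξ₂ j) = 0 := by
    intro c
    have huc : (∑ j, C (c j) * X j : MvPolynomial (Fin n) K₂).totalDegree + n * (d + 1 - 1) + 1 ≤
        1 + n * d + 1 := by
      have h1 : (∑ j, C (c j) * X j : MvPolynomial (Fin n) K₂).totalDegree ≤ 1 := by
        refine (totalDegree_finsetSum _ _).trans (Finset.sup_le fun j _ => ?_)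
        refine (totalDegree_mul _ _).trans ?_
        rw [totalDegree_C, zero_add, totalDegree_X]
      rw [Nat.add_sub_cancel]
      omega
    have h := eval_sLead_pertCharpoly_eq_zero_of_isolated (K := K₂) (D := d + 1) (Nat.succ_pos d)
      F₂ hdeg hz hg hfin' (∑ j, C (c j) * X j) huc
    have hPc : pertCharpoly (d + 1) F₂ (∑ j, C (c j) * X j) (1 + n * d + 1) =
        P.map (Polynomial.mapRingHom (ψ c)) := by
      rw [hP, pertCharpoly_map, hψu]
      congr 1
      funext i
      rw [hψF]
    rw [hPc] at h
    have hev : eval ξ₂ (∑ j, C (c j) * X j : MvPolynomial (Fin n) K₂) = ∑ j, c j * ξ₂ j := by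
      simp only [map_sum, map_mul, eval_C, eval_X]
    rw [hev] at h
    exact eval_map_sLead_eq_zero (ψ c) P _ h
  -- a polynomial identity in `Λ` over `K₂`
  let Ψ₂ : MvPolynomial ι ℤ →+* MvPolynomial (Fin n) K₂ :=
    eval₂Hom (Int.castRingHom _) (Sum.elim (fun k => C (T₂ k)) (Sum.elim (fun j => X j) (fun p => C (α p))))
  have hΨ₂c : ∀ c : Fin n → K₂, (eval c).comp Ψ₂ = ψ c := by
    intro c
    refine MvPolynomial.ringHom_ext (fun b => ?_) (fun v => ?_)
    · simp only [eq_intCast, map_intCast]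
    · rcases v with k | j | p
      · simp only [Ψ₂, ψ, RingHom.comp_apply, eval₂Hom_X', Sum.elim_inl, eval_C]
      · simp only [Ψ₂, ψ, RingHom.comp_apply, eval₂Hom_X', Sum.elim_inr, Sum.elim_inl, eval_X]
      · simp only [Ψ₂, ψ, RingHom.comp_apply, eval₂Hom_X', Sum.elim_inr, eval_C]
  have hG₂ : ((sLead P).map Ψ₂).eval (∑ j, C (ξ₂ j) * X j) = 0 := by
    apply MvPolynomial.funext
    intro c
    rw [map_zero]
    have h1 : eval c (((sLead P).map Ψ₂).eval (∑ j, C (ξ₂ j) * X j)) =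
        ((sLead P).map ((eval c).comp Ψ₂)).eval (eval c (∑ j, C (ξ₂ j) * X j)) := by
      rw [Polynomial.eval_map, Polynomial.hom_eval₂, Polynomial.eval_map]
    rw [h1, hΨ₂c]
    have h2 : eval c (∑ j, C (ξ₂ j) * X j : MvPolynomial (Fin n) K₂) = ∑ j, c j * ξ₂ j := by
      simp only [map_sum, map_mul, eval_C, eval_X, mul_comm]
    rw [h2]
    exact hlim c
  -- descent to `F₀[Λ, α]`: `Θ ∘ Ψ = Ψ₂` with `Θ` injective
  let Θ : MvPolynomial (Fin n ⊕ (Fin n × Fin t)) F₀ →+* MvPolynomial (Fin n) K₂ :=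
    eval₂Hom (C.comp jK) (Sum.elim (fun j => X j) (fun p => C (α p)))
  have hΘΨ : Θ.comp Ψ = Ψ₂ := by
    refine MvPolynomial.ringHom_ext (fun b => ?_) (fun v => ?_)
    · simp only [eq_intCast, map_intCast]
    · rcases v with k | j | p
      · simp only [Θ, Ψ, Ψ₂, T₂, RingHom.comp_apply, eval₂Hom_X', Sum.elim_inl, eval₂Hom_C]
      · simp only [Θ, Ψ, Ψ₂, RingHom.comp_apply, eval₂Hom_X', Sum.elim_inr, Sum.elim_inl]
      · simp only [Θ, Ψ, Ψ₂, RingHom.comp_apply, eval₂Hom_X', Sum.elim_inr]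
  have hΘpt : Θ (∑ j, C (φ (X j)) * X (Sum.inl j)) = ∑ j, C (ξ₂ j) * X j := by
    simp only [Θ, ξ₂, jK, map_sum, map_mul, eval₂Hom_C, eval₂Hom_X', Sum.elim_inl, RingHom.comp_apply]
  -- injectivity of `Θ`: `F₀[Λ, α] → K₁[Λ][α] → K₂[Λ]` coefficientwise along `K₁[α] ↪ K₂`
  have hΘinj : Function.Injective Θ := by
    let χ : MvPolynomial (Fin n × Fin t) K₁ →+* K₂ := (aeval α : MvPolynomial (Fin n × Fin t) K₁ →ₐ[K₁] K₂).toRingHom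
    have hχ : Function.Injective χ := by
      have := hα.1
      rw [algebraicIndependent_iff_injective_aeval] at this
      exact this
    let Θ' : MvPolynomial (Fin n ⊕ (Fin n × Fin t)) F₀ →+* MvPolynomial (Fin n) K₂ :=
      (MvPolynomial.map χ).comp
        ((sumAlgEquiv K₁ (Fin n) (Fin n × Fin t)).toRingEquiv.toRingHom.comp (MvPolynomial.map j₁))
    have hΘ' : Θ = Θ' := by
      refine MvPolynomial.ringHom_ext (fun b => ?_) (fun v => ?_)
      · simp only [Θ, Θ', jK, j₂, RingHom.comp_apply, eval₂Hom_C, MvPolynomial.map_C,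
          RingEquiv.toRingHom_eq_coe, RingEquiv.coe_toRingHom, AlgEquiv.coe_ringEquiv,
          sumAlgEquiv_C_inl, MvPolynomial.map_C]
        congr 1
        simp only [χ, AlgHom.toRingHom_eq_coe, RingHom.coe_coe, aeval_C]
      · rcases v with j | p
        · simp only [Θ, Θ', RingHom.comp_apply, eval₂Hom_X', Sum.elim_inl, MvPolynomial.map_X,
            RingEquiv.toRingHom_eq_coe, RingEquiv.coe_toRingHom, AlgEquiv.coe_ringEquiv,
            sumAlgEquiv_X_inl]
        · simp only [Θ, Θ', RingHom.comp_apply, eval₂Hom_X', Sum.elim_inr, MvPolynomial.map_X,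
            RingEquiv.toRingHom_eq_coe, RingEquiv.coe_toRingHom, AlgEquiv.coe_ringEquiv,
            sumAlgEquiv_X_inr, MvPolynomial.map_C]
          congr 1
          simp only [χ, AlgHom.toRingHom_eq_coe, RingHom.coe_coe, aeval_X]
    rw [hΘ']
    refine (MvPolynomial.map_injective χ hχ).comp ?_
    exact (sumAlgEquiv K₁ (Fin n) (Fin n × Fin t)).injective.comp (MvPolynomial.map_injective j₁ j₁.injective)
  -- conclusion
  apply hΘinj
  rw [map_zero]
  have h1 : Θ (((sLead P).map Ψ).eval (∑ j, C (φ (X j)) * X (Sum.inl j))) =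
      ((sLead P).map (Θ.comp Ψ)).eval (Θ (∑ j, C (φ (X j)) * X (Sum.inl j))) := by
    rw [Polynomial.eval_map, Polynomial.hom_eval₂, Polynomial.eval_map]
  rw [h1, hΘΨ, hΘpt]
  exact hG₂

end Main

end Summit.ValiantsHypothesis.ValiantsHypothesis.Theorems.LangWeilTransfer
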